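import Summits.RiemannHypothesis.RiemannHypothesis.Theses.NbGhostOfThePole
import Literature.NumberTheory.LFunctions.ApproxFunctionalEquation
import Literature.Barriers.RiemannHypothesis.TuranPartialSumsMontgomeryRouche
import Literature.Barriers.RiemannHypothesis.TuranPartialSumsInfinitude
import HarnessLib

/-!
# Route NbGhostOfThePole — crux `GhostZeroDisc` (stmt-RiemannHypothesis-22975)

THE GHOST OF THE POLE: for all large `M` the section `ζ_M(s) = Σ_{n ≤ M} n^{-s}` has a zero `ρ`
with `|ρ − (1 + 2πi/log M)| < 1/(2 log M)`.

Mechanism (Montgomery 1983, §4; Turán 1948): near `s = 1` the Euler–Maclaurin formula of order 0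
(tree: `Literature.NumberTheory.LFunctions.AFE.norm_zeta_sub_sum_add_le`, Titchmarsh (4.11.2))
`ζ(s) = ζ_M(s) − M^{1−s}/(1−s) + E_M(s)`, `‖E_M(s)‖ ≤ M^{−σ}(1/2 + |s|/(2σ))`, gives the EXACT
identity

  `(s − 1) ζ_M(s) − (1 − M^{1−s}) = (ζ₁(s) − 1) − (s − 1) E_M(s)`

with Mathlib's entire completion `ζ₁(s) = (s−1)ζ(s)` (`riemannZeta₁`, `ζ₁(1) = 1`).  On the closed
disc `|s − s₀| ≤ 1/(2 log M)`, `s₀ = 1 + 2πi/log M`, one has `|s − 1| ≤ 9/log M → 0`, so the first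
bracket is `< 1/16` by CONTINUITY of `ζ₁` at `1` (no rate needed — hence `∃ M₀` and no explicit
`M₀`), and the second is `≤ (1/4)(4/3)e^{−14} < 1/16` once `log M ≥ 36`.  Since
`M^{1−s} = e^{−log M (s − s₀)}` (because `e^{2πi} = 1`), this is the hypothesis of the tree's Rouché
step `Literature.Barriers.RiemannHypothesis.exists_zero_of_norm_sub_expModel_lt` (Montgomery's
§4 (25) about the explicit zero `s₀` of the model `1 − e^{−Λ(s−s₀)}`, margin `‖C‖/8`, `C = 1`,
`Λ = log M`) for the entire function `F(s) = (s−1)ζ_M(s)`; the zero it produces is not `s = 1`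
(`|1 − s₀| = 2π/log M > 1/(2 log M)`), so it is a zero of `ζ_M`.

Contents: §1 geometry of the Rouché disc; §2 the model `e^{−log M (s−s₀)} = M^{1−s}` and the
Euler–Maclaurin identity; §3 the uniform margin (`ghost_margin_eventually`); §4 the Rouché step and
the closer `GhostZeroDisc_proof : …Theses.NbGhostOfThePole.GhostZeroDisc` (by name).

RH-free, unconditional, no definitions, standard axioms.  References: H. L. Montgomery, *Zeros of
approximations to the zeta function*, in: Studies in Pure Mathematics (Birkhäuser, 1983) 497–506,
§4; P. Turán, Danske Vid. Selsk. Mat.-Fys. Medd. 24 (1948); E. C. Titchmarsh, *The Theory of the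
Riemann Zeta-Function*, 2nd ed. (1986), (4.11.2).  Numerically (route card) the zero is inside the
disc only from `M ≈ 10³`, so `∃ M₀` is the honest form.
No summit is proved by this file; nothing here bears on the truth of RH.
-/

noncomputable section

-- D-0017: `Summit.<S>.<S>.…` is the designed namespace of a single-problem summit.
set_option linter.dupNamespace false

open Complex Metric Set Filter Topology
open scoped Real

namespace Summit.RiemannHypothesis.RiemannHypothesis.Theorems.NbGhostOfThePole

open Literature.Barriers.RiemannHypothesis

/-! ## §1 — Geometry of the Rouché disc `|s − (1 + 2πi/L)| ≤ 1/(2L)` -/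

/-- The centre offset: `‖(1 + 2πi/L) − 1‖ = 2π/L` for `L > 0`. [folklore] -/
theorem norm_centre_sub_one {L : ℝ} (hL : 0 < L) :
    ‖((1 : ℂ) + 2 * (π : ℂ) / (L : ℂ) * I) - 1‖ = 2 * π / L := by
  have h : ((1 : ℂ) + 2 * (π : ℂ) / (L : ℂ) * I) - 1 = ((2 * π / L : ℝ) : ℂ) * I := by
    push_cast; ring
  rw [h, norm_mul, Complex.norm_I, mul_one, Complex.norm_real, Real.norm_eq_abs,
    abs_of_pos (by positivity)]

/-- On the closed disc `|s − (1 + 2πi/L)| ≤ 1/(2L)` (`L > 0`): `‖s − 1‖ ≤ 9/L` and `s ≠ 1`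
(`2π + 1/2 ≤ 9`; the centre is at distance `2π/L > 1/(2L)` from `1`). [folklore] -/
theorem norm_sub_one_le_of_mem_closedBall {L : ℝ} (hL : 0 < L) {s : ℂ}
    (hs : s ∈ closedBall ((1 : ℂ) + 2 * (π : ℂ) / (L : ℂ) * I) (1 / (2 * L))) :
    ‖s - 1‖ ≤ 9 / L ∧ s ≠ 1 := by
  rw [mem_closedBall, dist_eq_norm] at hs
  have hc := norm_centre_sub_one hL
  have hπ := Real.pi_lt_four
  have hπ0 := Real.pi_pos
  constructor
  · calc ‖s - 1‖ = ‖(s - ((1 : ℂ) + 2 * (π : ℂ) / (L : ℂ) * I)) +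
          (((1 : ℂ) + 2 * (π : ℂ) / (L : ℂ) * I) - 1)‖ := by congr 1; ring
      _ ≤ ‖s - ((1 : ℂ) + 2 * (π : ℂ) / (L : ℂ) * I)‖ +
          ‖((1 : ℂ) + 2 * (π : ℂ) / (L : ℂ) * I) - 1‖ := norm_add_le _ _
      _ ≤ 1 / (2 * L) + 2 * π / L := add_le_add hs hc.le
      _ ≤ 9 / L := by
          rw [div_add_div _ _ (by positivity) hL.ne', div_le_div_iff₀ (by positivity) hL]
          have h1 : 0 < L * L := mul_pos hL hL
          have h2 : 0 < (4 - π) * (L * L) * L := by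
            have : 0 < 4 - π := by linarith
            positivity
          nlinarith
  · intro h1
    rw [h1, norm_sub_rev, hc] at hs
    rw [div_le_div_iff₀ hL (by positivity)] at hs
    have h2 : 0 < (4 * π - 1) * L := by
      have : 0 < 4 * π - 1 := by linarith [Real.pi_gt_three]
      positivity
    nlinarith

/-- On the OPEN disc the same: a point of `|s − (1 + 2πi/L)| < 1/(2L)` is not `1`. [folklore] -/
theorem ne_one_of_mem_ball {L : ℝ} (hL : 0 < L) {s : ℂ}
    (hs : s ∈ ball ((1 : ℂ) + 2 * (π : ℂ) / (L : ℂ) * I) (1 / (2 * L))) : s ≠ 1 :=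
  (norm_sub_one_le_of_mem_closedBall hL (ball_subset_closedBall hs)).2

/-! ## §2 — The model `e^{−log M (s − s₀)} = M^{1−s}` and the Euler–Maclaurin identity -/

/-- `e^{−log M (s − (1 + 2πi/log M))} = M^{1−s}` for `M ≥ 2` (`e^{2πi} = 1`). [folklore] -/
theorem exp_neg_log_mul_sub_centre {M : ℕ} (hM : 2 ≤ M) (s : ℂ) :
    Complex.exp (-(Real.log M : ℂ) * (s - ((1 : ℂ) + 2 * (π : ℂ) / (Real.log M : ℂ) * I))) =
      (M : ℂ) ^ (1 - s) := by
  have hM0 : (0 : ℝ) < M := by exact_mod_cast (by omega : 0 < M)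
  have hL : 0 < Real.log M := Real.log_pos (by exact_mod_cast (by omega : 1 < M))
  have hLne : (Real.log M : ℂ) ≠ 0 := by exact_mod_cast hL.ne'
  have hMne : (M : ℂ) ≠ 0 := by exact_mod_cast (by omega : M ≠ 0)
  have hlog : Complex.log (M : ℂ) = (Real.log M : ℂ) := by
    rw [show (M : ℂ) = ((M : ℝ) : ℂ) by push_cast; rfl, (Complex.ofReal_log hM0.le).symm]
  have hexp : -(Real.log M : ℂ) * (s - ((1 : ℂ) + 2 * (π : ℂ) / (Real.log M : ℂ) * I)) =
      (Real.log M : ℂ) * (1 - s) + 2 * π * I := by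
    field_simp
    ring
  rw [hexp, Complex.exp_add, Complex.exp_two_pi_mul_I, mul_one, Complex.cpow_def_of_ne_zero hMne,
    hlog]

/-- **Euler–Maclaurin identity at the pole's ghost.** For `s ≠ 1`:
`(s−1)ζ_M(s) − (1 − M^{1−s}) = (ζ₁(s) − 1) − (s−1)·(ζ(s) − ζ_M(s) + M^{1−s}/(1−s))`,
`ζ₁ = riemannZeta₁` Mathlib's entire `(s−1)ζ(s)`. [cite: Titchmarsh1986, eq. (4.11.2)] -/
theorem sub_one_mul_zetaPartialSum_sub_model {s : ℂ} (hs1 : s ≠ 1) (M : ℕ) :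
    (s - 1) * zetaPartialSum M s - 1 * (1 - (M : ℂ) ^ (1 - s)) =
      (riemannZeta₁ s - 1) - (s - 1) * (riemannZeta s - ∑ n ∈ Finset.Icc 1 M, (n : ℂ) ^ (-s) +
        (M : ℂ) ^ (1 - s) / (1 - s)) := by
  have hζ₁ : riemannZeta₁ s = (s - 1) * riemannZeta s := by
    rw [riemannZeta_eq_inv_sub_mul hs1]; field_simp [sub_ne_zero.mpr hs1]
  have h1s : (1 - s) ≠ 0 := sub_ne_zero.mpr (Ne.symm hs1)
  rw [hζ₁, zetaPartialSum]
  field_simp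
  ring

/-! ## §3 — The uniform Rouché margin for large `M` -/

/-- **The margin.** There is `M₀` such that for every `M ≥ M₀` and every `s` in the closed disc
`|s − (1 + 2πi/log M)| ≤ 1/(2 log M)`:
`‖(s−1)ζ_M(s) − 1·(1 − e^{−log M (s − s₀)})‖ < ‖1‖/8`.
(`|ζ₁(s) − 1| < 1/16` by continuity of `ζ₁` at `1` once `9/log M < δ`; the Euler–Maclaurin
remainder term is `≤ (1/4)(4/3)e^{−14}` once `log M ≥ 36`.) [cite: Montgomery1983, §4 (25)]
[cite: Titchmarsh1986, eq. (4.11.2)] -/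
theorem ghost_margin_eventually : ∃ M₀ : ℕ, ∀ M : ℕ, M₀ ≤ M →
    ∀ s ∈ closedBall ((1 : ℂ) + 2 * (π : ℂ) / (Real.log M : ℂ) * I) (1 / (2 * Real.log M)),
      ‖(s - 1) * zetaPartialSum M s -
          1 * (1 - Complex.exp (-(Real.log M : ℂ) *
            (s - ((1 : ℂ) + 2 * (π : ℂ) / (Real.log M : ℂ) * I))))‖ < ‖(1 : ℂ)‖ / 8 := by
  -- continuity of `ζ₁` at `1`
  have hcont : ContinuousAt riemannZeta₁ 1 := differentiable_riemannZeta₁.continuous.continuousAt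
  obtain ⟨δ, hδ0, hδ⟩ := Metric.continuousAt_iff.mp hcont (1 / 16) (by norm_num)
  -- the threshold
  refine ⟨max ⌈Real.exp 36⌉₊ (⌈Real.exp (9 / δ)⌉₊ + 1), fun M hM s hs ↦ ?_⟩
  have hM36 : ⌈Real.exp 36⌉₊ ≤ M := le_trans (le_max_left _ _) hM
  have hMδ : ⌈Real.exp (9 / δ)⌉₊ + 1 ≤ M := le_trans (le_max_right _ _) hM
  have hMr36 : Real.exp 36 ≤ (M : ℝ) := le_trans (Nat.le_ceil _) (by exact_mod_cast hM36)
  have hMrδ : Real.exp (9 / δ) < (M : ℝ) := by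
    have h1 : Real.exp (9 / δ) ≤ ⌈Real.exp (9 / δ)⌉₊ := Nat.le_ceil _
    have h2 : (⌈Real.exp (9 / δ)⌉₊ : ℝ) < M := by exact_mod_cast hMδ
    exact lt_of_le_of_lt h1 h2
  have hM0 : (0 : ℝ) < M := lt_of_lt_of_le (Real.exp_pos _) hMr36
  have hM2 : 2 ≤ M := by
    have h3 : (3 : ℝ) ≤ (M : ℝ) := by
      have := Real.add_one_le_exp (36 : ℝ)
      linarith
    exact_mod_cast (by linarith : (2 : ℝ) ≤ M)
  have hM1 : 1 ≤ M := by omega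
  set L : ℝ := Real.log M with hLdef
  have hL36 : 36 ≤ L := by
    rw [hLdef, Real.le_log_iff_exp_le hM0]; exact hMr36
  have hL0 : 0 < L := by linarith
  have hLδ : 9 / L < δ := by
    have h : 9 / δ < L := by
      rw [hLdef, Real.lt_log_iff_exp_lt hM0]; exact hMrδ
    rw [div_lt_iff₀ hL0]
    rw [div_lt_iff₀ hδ0] at h
    linarith
  -- geometry of `s`
  obtain ⟨hs9, hs1⟩ := norm_sub_one_le_of_mem_closedBall hL0 hs
  have hs14 : ‖s - 1‖ ≤ 1 / 4 := by
    calc ‖s - 1‖ ≤ 9 / L := hs9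
      _ ≤ 1 / 4 := by rw [div_le_iff₀ hL0]; linarith
  have hσ : 3 / 4 ≤ s.re := by
    have h1 : |(s - 1).re| ≤ ‖s - 1‖ := Complex.abs_re_le_norm (s - 1)
    have h2 : (s - 1).re = s.re - 1 := by simp
    rw [h2] at h1
    have := (abs_le.mp (h1.trans hs14)).1
    linarith
  have hσ0 : 0 < s.re := by linarith
  have hsn : ‖s‖ ≤ 5 / 4 := by
    calc ‖s‖ = ‖(s - 1) + 1‖ := by ring_nf
      _ ≤ ‖s - 1‖ + ‖(1 : ℂ)‖ := norm_add_le _ _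
      _ ≤ 1 / 4 + 1 := by rw [norm_one]; exact add_le_add hs14 le_rfl
      _ = 5 / 4 := by norm_num
  -- first bracket: continuity of ζ₁
  have hA : ‖riemannZeta₁ s - 1‖ < 1 / 16 := by
    have h := hδ (x := s) (by rw [dist_eq_norm]; exact lt_of_le_of_lt hs9 hLδ)
    rwa [dist_eq_norm, riemannZeta₁_one] at h
  -- second bracket: the Euler–Maclaurin remainder
  set E : ℂ := riemannZeta s - ∑ n ∈ Finset.Icc 1 M, (n : ℂ) ^ (-s) +
      (M : ℂ) ^ (1 - s) / (1 - s) with hE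
  have hEle : ‖E‖ ≤ (M : ℝ) ^ (-s.re) * (1 / 2 + ‖s‖ / (2 * s.re)) :=
    Literature.NumberTheory.LFunctions.AFE.norm_zeta_sub_sum_add_le hσ0 hs1 hM1
  have hpow : (M : ℝ) ^ (-s.re) ≤ 1 / 15 := by
    rw [Real.rpow_def_of_pos hM0]
    have h1 : Real.log M * -s.re ≤ -14 := by
      rw [← hLdef]; nlinarith
    have h2 : Real.exp (Real.log M * -s.re) ≤ Real.exp (-14) := Real.exp_le_exp.mpr h1
    have h3 : Real.exp (-14 : ℝ) ≤ 1 / 15 := by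
      rw [Real.exp_neg, ← one_div]
      have := Real.add_one_le_exp (14 : ℝ)
      exact one_div_le_one_div_of_le (by norm_num) (by linarith)
    exact h2.trans h3
  have hfac : 1 / 2 + ‖s‖ / (2 * s.re) ≤ 4 / 3 := by
    have h1 : ‖s‖ / (2 * s.re) ≤ (5 / 4) / (2 * (3 / 4)) := by
      gcongr
    linarith [show (5 / 4 : ℝ) / (2 * (3 / 4)) = 5 / 6 by norm_num]
  have hB : ‖(s - 1) * E‖ ≤ 1 / 4 * (1 / 15 * (4 / 3)) := by
    rw [norm_mul]
    refine mul_le_mul hs14 (hEle.trans ?_) (norm_nonneg _) (by norm_num)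
    exact mul_le_mul hpow hfac (by positivity) (by norm_num)
  -- assemble
  rw [exp_neg_log_mul_sub_centre hM2 s, sub_one_mul_zetaPartialSum_sub_model hs1 M, ← hE,
    norm_one]
  calc ‖riemannZeta₁ s - 1 - (s - 1) * E‖ ≤ ‖riemannZeta₁ s - 1‖ + ‖(s - 1) * E‖ := norm_sub_le _ _
    _ < 1 / 16 + 1 / 4 * (1 / 15 * (4 / 3)) := add_lt_add_of_lt_of_le hA hB
    _ ≤ 1 / 8 := by norm_num

/-! ## §4 — The Rouché step and the crux -/

/-- **Rouché step.** If `M ≥ 2` and the margin holds on the closed disc, then `ζ_M` has a zero in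
the open disc `|ρ − (1 + 2πi/log M)| < 1/(2 log M)` (tree lemma
`exists_zero_of_norm_sub_expModel_lt` for the entire `F(s) = (s−1)ζ_M(s)`, `C = 1`, `Λ = log M`;
the zero is not `1`). [cite: Montgomery1983, §4 (Rouché, p. 506)] -/
theorem exists_zetaPartialSum_zero_of_margin {M : ℕ} (hM : 2 ≤ M)
    (hmargin : ∀ s ∈ closedBall ((1 : ℂ) + 2 * (π : ℂ) / (Real.log M : ℂ) * I)
      (1 / (2 * Real.log M)),
      ‖(s - 1) * zetaPartialSum M s -
          1 * (1 - Complex.exp (-(Real.log M : ℂ) *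
            (s - ((1 : ℂ) + 2 * (π : ℂ) / (Real.log M : ℂ) * I))))‖ < ‖(1 : ℂ)‖ / 8) :
    ∃ ρ ∈ ball ((1 : ℂ) + 2 * (π : ℂ) / (Real.log M : ℂ) * I) (1 / (2 * Real.log M)),
      zetaPartialSum M ρ = 0 := by
  have hL : 0 < Real.log M := Real.log_pos (by exact_mod_cast (by omega : 1 < M))
  have hF : DiffContOnCl ℂ (fun s ↦ (s - 1) * zetaPartialSum M s)
      (ball ((1 : ℂ) + 2 * (π : ℂ) / (Real.log M : ℂ) * I) (1 / (2 * Real.log M))) :=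
    ((differentiable_id.sub_const 1).mul (differentiable_zetaPartialSum M)).diffContOnCl
  obtain ⟨ρ, hρ, hFρ⟩ := exists_zero_of_norm_sub_expModel_lt (F := fun s ↦ (s - 1) *
    zetaPartialSum M s) (C := 1) hL one_ne_zero hF hmargin
  refine ⟨ρ, hρ, ?_⟩
  have hρ1 : ρ - 1 ≠ 0 := sub_ne_zero.mpr (ne_one_of_mem_ball hL hρ)
  exact (mul_eq_zero.mp hFρ).resolve_left hρ1

/-- **The ghost zero.** There is `M₀` such that every section `ζ_M`, `M ≥ M₀`, has a zero `ρ` with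
`‖ρ − (1 + 2πi/log M)‖ < 1/(2 log M)`. [cite: Montgomery1983, §4] [cite: Turan1948, §3] -/
theorem exists_ghost_zero : ∃ M₀ : ℕ, ∀ M : ℕ, M₀ ≤ M → ∃ ρ : ℂ, zetaPartialSum M ρ = 0 ∧
    ‖ρ - ((1 : ℂ) + 2 * (π : ℂ) / (Real.log M : ℂ) * I)‖ < 1 / (2 * Real.log M) := by
  obtain ⟨M₀, hM₀⟩ := ghost_margin_eventually
  refine ⟨max M₀ 2, fun M hM ↦ ?_⟩
  have h0 : M₀ ≤ M := le_trans (le_max_left _ _) hM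
  have h2 : 2 ≤ M := le_trans (le_max_right _ _) hM
  obtain ⟨ρ, hρ, hζ⟩ := exists_zetaPartialSum_zero_of_margin h2 (hM₀ M h0)
  refine ⟨ρ, hζ, ?_⟩
  rwa [mem_ball, dist_eq_norm] at hρ

/-- **Closer of item stmt-RiemannHypothesis-22975** (route `NbGhostOfThePole`, crux r2), by name:
`GhostZeroDisc` — for all large `M`, `ζ_M` vanishes within `1/(2 log M)` of `1 + 2πi/log M`
(`exists_ghost_zero`).  RH-free; no summit is proved by this; nothing here bears on the truth of
RH. [cite: Montgomery1983, §4] -/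
theorem GhostZeroDisc_proof :
    Summit.RiemannHypothesis.RiemannHypothesis.Theses.NbGhostOfThePole.GhostZeroDisc := by
  unfold Summit.RiemannHypothesis.RiemannHypothesis.Theses.NbGhostOfThePole.GhostZeroDisc
  obtain ⟨M₀, hM₀⟩ := exists_ghost_zero
  refine ⟨M₀, fun M hM ↦ ?_⟩
  obtain ⟨ρ, hζ, hρ⟩ := hM₀ M hM
  exact ⟨ρ, hζ, by simpa using hρ⟩

end Summit.RiemannHypothesis.RiemannHypothesis.Theorems.NbGhostOfThePole

end
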